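import Summits.QuantumFields.YangMills.Theorems.BalabanUVNodesN20TwoRunKeyedPersistentWeight

/-!
# BalabanUVNodes ∕ N20 (NE7b) — NODE U5d's PARTIAL SUMMATION OF RUN B INTO RUN A's CLASSES SUMS ONLY OVER RUN B's FIRST-STEP HISTORY, AND OVER N20's GOOD KEYS IT IS
# NO SUMMATION: the flow-free truncation `truncShift` («drop level 1, block down by L») is INJECTIVE ABOVE LEVEL 1 (the window domains `𝐃^B_{j+1}` are `L`-aligned), so a
# run-B keyed class is parametrised by the level-1 pair `(Ω'_1, Λ'_1)`; over a run-A index with `Ω_1 = T_η` — e.g. one WITHOUT an old large-field region — (2.1) forces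
# `Λ'_1 = Ω'_1 = T_η` and the fibre is the SINGLE lifted term `liftSeq s`

Cell `pub-ymgap` (HUMAN RULING D-0062 Track A; work-bound push D-0149, director-ym №197), width seat `pub-ymgap-dag-n20-w2` (gen 0) on node N20 = NE7b; successor piece of
plan g77 `W-SEAT-START-LIST.md` v3 §2 n20 ITEM 2 (module 1 = `…N20TwoRunKeyedPersistentWeight`, p584315: the BAD keys; this module: the complement — what run B's keyed class
IS over a key WITHOUT old activity).  Filed `--kind proof --supports stmt-QuantumFields-20544 --as helper` (K3⁷ `SpineGivenEndpointR13SepCoPH`); COUNT-NEUTRAL.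
[III] = [Balaban1988Convergent], [LF-I] = [Balaban1989LargeFieldI], [RG1] = [Balaban1987RG1].  (α) READING as in module 1 (`Bad K t := badKeysSigma F (T K) jcut`, dag-n20-d).

WHY.  N19's keyed faces (n19-d B p571597 :169) read run B through node U5d's key `kB = ⟨K, twoRunKeyB …⟩ = ⟨K, seqKey ∘ truncShift⟩`: a keyed class of run B is a FIBRE of
the block-down truncation, and dag-n20-w3's `hedge` companion compares, on the GOOD class, run A's term `s` with the fibre SUM `Σ_{s' : truncSeq s' = s}` of run B.  Module 1 §1
(`blockUpSet ∘ blockDownSet = id` on `𝐃^B_{j+1}`) makes that fibre explicit: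
* §1 `truncShift_eq_iff_window` (a fibre element over `s₀` has `Ω'_{j+1} = blockUpSet Ω₀_j`, `Λ'_{j+1} = blockUpSet Λ₀_j`, `1 ≤ j ≤ k`) · `truncShift_eq_truncShift_iff` (INJECTIVE
  ABOVE LEVEL 1) · `eq_of_truncShift_eq_of_levelOne_eq` (an index = its level-1 pair + its truncation);
* §2 `seq_Λ_one_eq_univ_of_Ω_two` ((2.1): `Ω_2 ⊆ Λ_1 ⊆ Ω_1`) · ★ `eq_of_twoRunKeyB_eq_of_fst_one_eq_univ` (FLOW-FREE: the `kB`-fibre over a key whose first `Ω`-entry is `T_η`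
  has at most one element, `k ≥ 1`) · `card_filter_twoRunKeyB_le_one_of_fst_one_eq_univ` (card `≤ 1`: EMPTY or ONE term, never a genuine partial sum);
* §3 under `RAgree`: `truncShift_eq_of_truncSeq_eq` · `liftSeq_Λ_one` · ★ `truncSeq_eq_iff_eq_liftSeq_of_Ω_one` (`truncSeq s' = s ↔ s' = liftSeq s` when `s.Ω_1 = T_η`, `k ≥ 1`)
  · ★ `filter_truncSeq_eq_singleton_liftSeq`;
* §4 at the σ-packed keys: ★★ `sum_filter_sigma_twoRunKeyB_keyA_eq_liftSeq` (run B's keyed class weight over `kA s` = `w (liftSeq s)` for ANY weight `w`) · ★★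
  `sum_fiberB_eq_liftSeq_of_not_mem_badKeysSigma` (on N20's GOOD class, policy `1 ≤ jcut K ≤ K₀+K`: `Λ_1 = T_η` by dag-n20-d's `Λ_eq_univ_of_mem_sdiff_badKeysSigma_twoRunKeyA`,
  so ONE TERM) — so N19's core edge ∕ N21's shell compare, key by good key, run A's (2.18) TERM with run B's LIFTED TERM; the level-1 freedom of run B lives ONLY over keys with
  `Ω_1 ≠ T_η`, i.e. with a large-field region already at run A's first level — which are OLD-BAD for every policy `jcut K ≥ 1` (module 1).
* §5 sanity ∕ A6 (the hypothesis `Ω_1 = T_η` is inhabited): `truncSeq_top` · `liftSeq_top` · `filter_truncSeq_eq_top` — the NO-LARGE-FIELD indices of the two runs ([LF-I] (0.2)'s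
  `ρ(∅, V)` terms) are each other's ONLY partners: the fibre over `top_A` is `{top_B}` (`k ≥ 1`).
  And the other side: `exists_sigma_twoRunKeyA_mem_badKeysSigma` — the ALL-LARGE-FIELD index is BAD (`1 ≤ jcut K ≤ k`): the persistence class is neither empty nor
  everything at any cutoff; the weights decide.
Cited BY NAME, not re-typed: dag-n20-d `Node00/TwoRunSite{Transport,Key,Lift,Persistence}` (`truncShift_Ω∕_Λ∕_Ω_off`, `twoRunKeyB_eq_iff`, `twoRunKeyB_fst`, `liftSeq`,
`liftSeq_Ω_one∕_Ω_succ∕_Λ_succ`, `truncSeq_liftSeq`, `truncSeq_Ω_eq_truncShift_Ω`, `Λ_eq_univ_of_mem_sdiff_badKeysSigma_twoRunKeyA`), n19-d B §1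
(`sum_filter_sigma_twoRunKeyB_keyA_eq_sum_filter_truncSeq`), module 1 §1.

HONEST FRAMING.  Finite bookkeeping + torus geometry (Mathlib + tree shapes BY NAME); NO weight is bounded, NO estimate proved; it only SHARPENS what N19's core edge and N21's
shell have to compare on N20's good class.  Nothing of Bałaban's is asserted; NE7 ∕ NE7b ∕ NE7c NOT PRINTED for `d = 4`, NOT proved; (α)-instance 0∕1; N19 ∕ N20 ∕ N21 ∕ N27
NOT discharged; K3⁷ NOT closed; counts unmoved (typed 28∕28 · discharged 5∕27); no count claim.  One finite `𝕋⁴_{L^K}` programme at fixed `ε = L^{−K}` along two consecutive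
cutoffs, Bałaban AS PRINTED; the YM mass gap (Clay) is NOT proved by any of this — R4 closes the conditional finite-𝕋⁴ rung `BalabanLadder.UV` only; NOT ℝ⁴, NOT OS.
No `def`, no `instance`, no `notation`, no `sorry`.  Sources (bookkeeping): [III] (2.1) p.254, (2.5) p.255, (2.18) p.257; [LF-I] (0.2) p.176; [RG1] (0.3) p.252; [King1986] (3.10) p.656.
-/

noncomputable section

open scoped BigOperators

namespace Summit.QuantumFields.YangMills.BalabanUVNodes.N20TwoRunKeyedGoodFibre

open Literature.MathematicalPhysics.QuantumFieldTheory.Balaban1983to89 Literature.MathematicalPhysics.QuantumFieldTheory.Balaban1983to89.Node00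
open T4Continuum B14.Eq213MaximalDomains B15Eq112TorusCover B14DomainGeom B14.Eq218Concrete
open Summit.QuantumFields.YangMills.BalabanUVNodes.N20TwoRunKeyedPersistentWeight
  (blockUpSet_blockDownSet_of_mem_dOfRecord_succ blockDownSet_eq_univ_iff_of_mem_dOfRecord_succ)

variable (F : T4Family)

/-! ## §1  The flow-free truncation forgets EXACTLY run B's level-1 pair -/

section Shift

variable (ν : Stage7Numerics) {M : ℕ} (hM : 0 < M) (gB : ℕ → ℝ) {K k : ℕ}

/-- **A RUN-B INDEX IN THE FIBRE OVER `s₀` HAS ITS WINDOW ENTRIES ABOVE LEVEL 1 DETERMINED**: `truncShift s' = s₀` iff `Ω'_{j+1} = blockUpSet (Ω₀_j)` and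
`Λ'_{j+1} = blockUpSet (Λ₀_j)` for `1 ≤ j ≤ k` — the block-down is injective on the `L`-aligned unions of cubes `𝐃^B_{j+1}` (`blockUpSet_blockDownSet_of_mem_dOfRecord_succ`).
[cite: Balaban1988Convergent, (2.1) p.254, (2.18) p.257; Balaban1987RG1, (0.3) p.252 (bookkeeping)] -/
theorem truncShift_eq_iff_window (s' : SeqOfRecord F ν M gB (K + 1) (k + 1)) (s₀ : Seq (DOfRecord F ν M (fun j => gB (j + 1)) K) k) :
    truncShift F ν hM gB s' = s₀ ↔
      ∀ j, 1 ≤ j → j ≤ k → s'.Ω (j + 1) = blockUpSet F K (s₀.Ω j) ∧ s'.Λ (j + 1) = blockUpSet F K (s₀.Λ j) := by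
  constructor
  · rintro rfl j h1 hj
    refine ⟨?_, ?_⟩
    · rw [truncShift_Ω F ν hM gB s' h1 hj,
        blockUpSet_blockDownSet_of_mem_dOfRecord_succ F ν M gB K j (s'.chain.memΩ (j + 1) (by omega) (by omega))]
    · rw [truncShift_Λ F ν hM gB s' h1 hj,
        blockUpSet_blockDownSet_of_mem_dOfRecord_succ F ν M gB K j (s'.chain.memΛ (j + 1) (by omega) (by omega))]
  · intro h
    apply Seq.ext'
    · funext j
      by_cases hj : 1 ≤ j ∧ j ≤ k
      · rw [truncShift_Ω F ν hM gB s' hj.1 hj.2, (h j hj.1 hj.2).1, blockDownSet_blockUpSet]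
      · rw [truncShift_Ω_off F ν hM gB s' hj, s₀.Ω_off j hj]
    · funext j
      by_cases hj : 1 ≤ j ∧ j ≤ k
      · rw [truncShift_Λ F ν hM gB s' hj.1 hj.2, (h j hj.1 hj.2).2, blockDownSet_blockUpSet]
      · rw [(truncShift F ν hM gB s').Λ_off j hj, s₀.Λ_off j hj]

/-- **`truncShift` IS INJECTIVE ABOVE LEVEL 1**: two admissible run-B indices have the same flow-free truncation iff their window entries at the levels `2, …, k+1`
coincide. [cite: Balaban1988Convergent, (2.1) p.254, (2.18) p.257 (bookkeeping)] -/
theorem truncShift_eq_truncShift_iff (s' s'' : SeqOfRecord F ν M gB (K + 1) (k + 1)) :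
    truncShift F ν hM gB s' = truncShift F ν hM gB s'' ↔
      ∀ j, 1 ≤ j → j ≤ k → s'.Ω (j + 1) = s''.Ω (j + 1) ∧ s'.Λ (j + 1) = s''.Λ (j + 1) := by
  rw [truncShift_eq_iff_window]
  refine forall_congr' fun j => forall_congr' fun h1 => forall_congr' fun hj => ?_
  rw [truncShift_Ω F ν hM gB s'' h1 hj, truncShift_Λ F ν hM gB s'' h1 hj,
    blockUpSet_blockDownSet_of_mem_dOfRecord_succ F ν M gB K j (s''.chain.memΩ (j + 1) (by omega) (by omega)),
    blockUpSet_blockDownSet_of_mem_dOfRecord_succ F ν M gB K j (s''.chain.memΛ (j + 1) (by omega) (by omega))]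

/-- **… SO A RUN-B INDEX IS ITS LEVEL-1 PAIR PLUS ITS TRUNCATION**: equal truncations and equal `(Ω_1, Λ_1)` give equal indices — node U5d's keyed class of run B is
parametrised by run B's FIRST-STEP history `(Ω'_1, Λ'_1)` alone. [cite: Balaban1988Convergent, (2.1) p.254, (2.18) p.257 (bookkeeping)] -/
theorem eq_of_truncShift_eq_of_levelOne_eq {s' s'' : SeqOfRecord F ν M gB (K + 1) (k + 1)}
    (h : truncShift F ν hM gB s' = truncShift F ν hM gB s'') (hΩ : s'.Ω 1 = s''.Ω 1) (hΛ : s'.Λ 1 = s''.Λ 1) : s' = s'' := by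
  rw [truncShift_eq_truncShift_iff] at h
  apply Seq.ext'
  · funext j
    rcases j with _ | _ | i
    · rw [s'.Ω_off 0 (by omega), s''.Ω_off 0 (by omega)]
    · exact hΩ
    · by_cases hi : i + 1 ≤ k
      · exact (h (i + 1) (by omega) hi).1
      · rw [s'.Ω_off (i + 2) (by omega), s''.Ω_off (i + 2) (by omega)]
  · funext j
    rcases j with _ | _ | i
    · rw [s'.Λ_off 0 (by omega), s''.Λ_off 0 (by omega)]
    · exact hΛ
    · by_cases hi : i + 1 ≤ k
      · exact (h (i + 1) (by omega) hi).2
      · rw [s'.Λ_off (i + 2) (by omega), s''.Λ_off (i + 2) (by omega)]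

end Shift

/-! ## §2  An admissible index whose level-2 domain is the whole torus has no level-1 large field either -/

/-- **(2.1) at the first two levels**: `Ω_2 ⊆ Λ_1 ⊆ Ω_1`, so `Ω_2 = T_η` forces `Λ_1 = Ω_1 = T_η` (length `≥ 2`). [cite: Balaban1988Convergent, (2.1) p.254 (bookkeeping)] -/
theorem seq_Λ_one_eq_univ_of_Ω_two {α : Type*} {D : ℕ → Set (Set α)} {k' : ℕ} (s : Seq D k') (hk : 2 ≤ k') (h : s.Ω 2 = Set.univ) :
    s.Λ 1 = Set.univ ∧ s.Ω 1 = Set.univ := by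
  have hΛ : s.Λ 1 = Set.univ := Set.eq_univ_of_univ_subset (h ▸ s.chain.Ω_succ_subset 1 le_rfl (by omega))
  exact ⟨hΛ, Set.eq_univ_of_univ_subset (hΛ ▸ s.chain.Λ_subset 1 le_rfl (by omega))⟩

/-- **FLOW-FREE: THE KEYED FIBRE OF RUN B OVER A KEY WITH `Ω_1 = T_η` HAS AT MOST ONE ELEMENT** (`k ≥ 1`): two run-B indices with the same coupling-free key whose first
`Ω`-entry is the whole cutoff-`K` torus coincide — their truncations agree (`seqKey` injective), their `Ω'_2` block down onto `T_η` hence ARE `T_η` (landed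
`blockDownSet_eq_univ_iff_of_mem_dOfRecord_succ`), and §2 fixes their level-1 pairs. [cite: Balaban1988Convergent, (2.1) p.254, (2.18) p.257 (bookkeeping)] -/
theorem eq_of_twoRunKeyB_eq_of_fst_one_eq_univ (ν : Stage7Numerics) {M : ℕ} (hM : 0 < M) (gB : ℕ → ℝ) {K k : ℕ} (hk : 1 ≤ k)
    {x : SiteSeqKey F K} (hx : x.1 1 = Set.univ) {s' s'' : SeqOfRecord F ν M gB (K + 1) (k + 1)}
    (h' : twoRunKeyB F ν hM gB K k s' = x) (h'' : twoRunKeyB F ν hM gB K k s'' = x) : s' = s'' := by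
  have hΩ2 : ∀ {s : SeqOfRecord F ν M gB (K + 1) (k + 1)}, twoRunKeyB F ν hM gB K k s = x → s.Ω 2 = Set.univ := by
    intro s hs
    have h1 : blockDownSet F K (s.Ω (1 + 1)) = Set.univ := by
      rw [← twoRunKeyB_fst F ν hM gB K k s le_rfl hk, hs, hx]
    exact (blockDownSet_eq_univ_iff_of_mem_dOfRecord_succ F ν M gB K 1 (s.chain.memΩ (1 + 1) (by omega) (by omega))).1 h1
  have htr : truncShift F ν hM gB s' = truncShift F ν hM gB s'' := (twoRunKeyB_eq_iff F ν hM gB K k s' s'').1 (h'.trans h''.symm)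
  obtain ⟨hΛ', hΩ'⟩ := seq_Λ_one_eq_univ_of_Ω_two s' (by omega) (hΩ2 h')
  obtain ⟨hΛ'', hΩ''⟩ := seq_Λ_one_eq_univ_of_Ω_two s'' (by omega) (hΩ2 h'')
  exact eq_of_truncShift_eq_of_levelOne_eq F ν hM gB htr (hΩ'.trans hΩ''.symm) (hΛ'.trans hΛ''.symm)

open Classical in
/-- **… AS A COUNT**: flow-free, the `kB`-fibre over a key whose first `Ω`-entry is `T_η` has card `≤ 1` (`k ≥ 1`) — EMPTY or ONE run-B term, never a genuine partial sum.
[cite: Balaban1988Convergent, (2.1) p.254, (2.18) p.257 (bookkeeping)] -/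
theorem card_filter_twoRunKeyB_le_one_of_fst_one_eq_univ (ν : Stage7Numerics) {M : ℕ} (hM : 0 < M) (gB : ℕ → ℝ) {K k : ℕ} (hk : 1 ≤ k)
    {x : SiteSeqKey F K} (hx : x.1 1 = Set.univ) :
    (Finset.univ.filter (fun s' : SeqOfRecord F ν M gB (K + 1) (k + 1) => twoRunKeyB F ν hM gB K k s' = x)).card ≤ 1 :=
  Finset.card_le_one.2 fun _ hs' _ hs'' =>
    eq_of_twoRunKeyB_eq_of_fst_one_eq_univ F ν hM gB hk hx (Finset.mem_filter.1 hs').2 (Finset.mem_filter.1 hs'').2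

/-! ## §3  Under `RAgree`: the fibre of the truncation over a run-A index with `Ω_1 = T_η` is `{liftSeq s}` -/

section Agree

variable (ν : Stage7Numerics) {M : ℕ} (hM : 0 < M) {gA gB : ℕ → ℝ} {K k : ℕ} (hR : RAgree F ν gA gB k)

/-- Under `RAgree`, equal `truncSeq` ⇒ equal flow-free `truncShift` (they have the same entries, `Node00.truncSeq_Ω_eq_truncShift_Ω` ∕ `…_Λ_…`).
[cite: Balaban1988Convergent, (2.5) p.255, (2.18) p.257 (bookkeeping)] -/
theorem truncShift_eq_of_truncSeq_eq {s' s'' : SeqOfRecord F ν M gB (K + 1) (k + 1)}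
    (h : truncSeq F ν hM hR s' = truncSeq F ν hM hR s'') : truncShift F ν hM gB s' = truncShift F ν hM gB s'' :=
  Seq.ext'
    (by rw [← truncSeq_Ω_eq_truncShift_Ω F ν hM hR s', ← truncSeq_Ω_eq_truncShift_Ω F ν hM hR s'', h])
    (by rw [← truncSeq_Λ_eq_truncShift_Λ F ν hM hR s', ← truncSeq_Λ_eq_truncShift_Λ F ν hM hR s'', h])

/-- Level `1` of the lift: `Λ'_1 = T_η` (companion of `Node00.liftSeq_Ω_one`). [cite: Balaban1988Convergent, (2.18) p.257 (bookkeeping)] -/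
theorem liftSeq_Λ_one (s : SeqOfRecord F ν M gA K k) : (liftSeq F ν hM hR s).Λ 1 = Set.univ := by
  unfold liftSeq
  rw [Seq.ofChain_Λ _ le_rfl (by omega), liftFun_one]

/-- **★ THE `truncSeq`-FIBRE OVER A RUN-A INDEX WITH `Ω_1 = T_η` IS THE LIFT ALONE** (`k ≥ 1`): `truncSeq s' = s ↔ s' = liftSeq s`.  A run-B partner `s'` has
`blockDownSet Ω'_2 = Ω_1 = T_η`, so `Ω'_2 = T_η`, so `Λ'_1 = Ω'_1 = T_η` by (2.1) — the level-1 pair is forced, and above level 1 the truncation is injective (§1).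
[cite: Balaban1988Convergent, (2.1) p.254, (2.5) p.255, (2.18) p.257 (bookkeeping)] -/
theorem truncSeq_eq_iff_eq_liftSeq_of_Ω_one (hk : 1 ≤ k) (s : SeqOfRecord F ν M gA K k) (hΩ : s.Ω 1 = Set.univ)
    (s' : SeqOfRecord F ν M gB (K + 1) (k + 1)) : truncSeq F ν hM hR s' = s ↔ s' = liftSeq F ν hM hR s := by
  refine ⟨fun h => ?_, fun h => h ▸ truncSeq_liftSeq F ν hM hR s⟩
  have hΩ2 : s'.Ω 2 = Set.univ := by
    have h1 : blockDownSet F K (s'.Ω (1 + 1)) = Set.univ := by rw [← truncSeq_Ω F ν hM hR s' le_rfl hk, h, hΩ]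
    exact (blockDownSet_eq_univ_iff_of_mem_dOfRecord_succ F ν M gB K 1 (s'.chain.memΩ (1 + 1) (by omega) (by omega))).1 h1
  obtain ⟨hΛ1, hΩ1⟩ := seq_Λ_one_eq_univ_of_Ω_two s' (by omega) hΩ2
  refine eq_of_truncShift_eq_of_levelOne_eq F ν hM gB
    (truncShift_eq_of_truncSeq_eq F ν hM hR (h.trans (truncSeq_liftSeq F ν hM hR s).symm)) ?_ ?_
  · rw [hΩ1, liftSeq_Ω_one]
  · rw [hΛ1, liftSeq_Λ_one]

open Classical in
/-- **★ AS A FINSET**: the `truncSeq`-fibre over a run-A index with `Ω_1 = T_η` is the singleton `{liftSeq s}` (`k ≥ 1`).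
[cite: Balaban1988Convergent, (2.18) p.257 (bookkeeping)] -/
theorem filter_truncSeq_eq_singleton_liftSeq (hk : 1 ≤ k) (s : SeqOfRecord F ν M gA K k) (hΩ : s.Ω 1 = Set.univ) :
    Finset.univ.filter (fun s' : SeqOfRecord F ν M gB (K + 1) (k + 1) => truncSeq F ν hM hR s' = s) = {liftSeq F ν hM hR s} := by
  ext s'
  simp only [Finset.mem_filter, Finset.mem_univ, true_and, Finset.mem_singleton]
  exact truncSeq_eq_iff_eq_liftSeq_of_Ω_one F ν hM hR hk s hΩ s'

end Agree

/-! ## §4  At the σ-packed two-run keys: over a run-A key with `Ω_1 = T_η` — in particular over N20's GOOD class — run B's keyed class weight is ONE TERM -/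

section Keys

variable (ν : Stage7Numerics) (K₀ : ℕ) {M : ℕ} (hM : 0 < M) [∀ Kc, DecidableEq (SiteSeqKey F Kc)]

open Classical in
/-- **★★ RUN B's KEYED CLASS WEIGHT OVER `kA s` IS THE WEIGHT OF THE LIFTED TERM** (under `RAgree`, run A's index with `Ω_1 = T_η`, `K₀ + K ≥ 1`): for ANY weight `w` on run
B's admissible indices, `Σ_{s' : kB s' = kA s} w s' = w (liftSeq s)` — node U5d's «partial summation» over such a key is NO summation (n19-d's
`sum_filter_sigma_twoRunKeyB_keyA_eq_sum_filter_truncSeq` + §3). [cite: Balaban1988Convergent, (2.5) p.255, (2.18) p.257; King1986, (3.10) p.656 (bookkeeping)] -/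
theorem sum_filter_sigma_twoRunKeyB_keyA_eq_liftSeq {gA gB : ℕ → ℕ → ℝ} {K : ℕ} (hR : RAgree F ν (gA K) (gB K) (K₀ + K)) (hk : 1 ≤ K₀ + K)
    {β : Type*} [AddCommMonoid β] (w : SeqOfRecord F ν M (gB K) (K₀ + K + 1) (K₀ + K + 1) → β) (s : SeqOfRecord F ν M (gA K) (K₀ + K) (K₀ + K))
    (hΩ : s.Ω 1 = Set.univ) :
    ∑ s' ∈ Finset.univ.filter (fun s' : SeqOfRecord F ν M (gB K) (K₀ + K + 1) (K₀ + K + 1) =>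
        (⟨K, twoRunKeyB F ν hM (gB K) (K₀ + K) (K₀ + K) s'⟩ : Σ K, SiteSeqKey F (K₀ + K)) = ⟨K, twoRunKeyA F ν M (gA K) (K₀ + K) (K₀ + K) s⟩), w s'
      = w (liftSeq F ν hM hR s) := by
  rw [N19TargetClassWeightsTwoRunKeyed.sum_filter_sigma_twoRunKeyB_keyA_eq_sum_filter_truncSeq F ν K₀ hM hR w s,
    filter_truncSeq_eq_singleton_liftSeq F ν hM hR hk s hΩ, Finset.sum_singleton]

open Classical in
/-- **★★ ON N20's GOOD CLASS THE PARTIAL SUMMATION IS ONE TERM**: if run A's σ-key `⟨K, kA s⟩` lies in a class set `T` but NOT in the persistence bad class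
`badKeysSigma F T jcut` (policy `1 ≤ jcut K ≤ K₀ + K`), then `Λ_1 = T_η` (`Node00.Λ_eq_univ_of_mem_sdiff_badKeysSigma_twoRunKeyA`), hence `Ω_1 = T_η`, hence under `RAgree`
run B's keyed class weight over that key is `w (liftSeq s)` for ANY weight `w` — N19's core edge and N21's shell compare, on good keys, run A's TERM with run B's LIFTED TERM.
[cite: Balaban1989LargeFieldI, (0.2) p.176; Balaban1988Convergent, (2.1) p.254, (2.18) p.257; King1986, (3.10) p.656 (bookkeeping)] -/
theorem sum_fiberB_eq_liftSeq_of_not_mem_badKeysSigma {gA gB : ℕ → ℕ → ℝ} {K : ℕ} (hR : RAgree F ν (gA K) (gB K) (K₀ + K))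
    (T : Finset (Σ K, SiteSeqKey F (K₀ + K))) (jcut : ℕ → ℕ) (hj1 : 1 ≤ jcut K) (hjK : jcut K ≤ K₀ + K)
    {β : Type*} [AddCommMonoid β] (w : SeqOfRecord F ν M (gB K) (K₀ + K + 1) (K₀ + K + 1) → β) (s : SeqOfRecord F ν M (gA K) (K₀ + K) (K₀ + K))
    (hgood : (⟨K, twoRunKeyA F ν M (gA K) (K₀ + K) (K₀ + K) s⟩ : Σ K, SiteSeqKey F (K₀ + K)) ∈ T \ badKeysSigma F T jcut) :
    ∑ s' ∈ Finset.univ.filter (fun s' : SeqOfRecord F ν M (gB K) (K₀ + K + 1) (K₀ + K + 1) =>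
        (⟨K, twoRunKeyB F ν hM (gB K) (K₀ + K) (K₀ + K) s'⟩ : Σ K, SiteSeqKey F (K₀ + K)) = ⟨K, twoRunKeyA F ν M (gA K) (K₀ + K) (K₀ + K) s⟩), w s'
      = w (liftSeq F ν hM hR s) :=
  sum_filter_sigma_twoRunKeyB_keyA_eq_liftSeq F ν K₀ hM hR (hj1.trans hjK) w s
    ((Λ_eq_univ_of_mem_sdiff_badKeysSigma_twoRunKeyA F ν M (gA K) T jcut K (K₀ + K) s hgood le_rfl hj1).2 (hj1.trans hjK))

end Keys

/-! ## §5  Sanity ∕ A6: the hypothesis `Ω_1 = T_η` is inhabited — the NO-LARGE-FIELD indices of the two runs are each other's ONLY partners -/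

section Top

variable (ν : Stage7Numerics) {M : ℕ} (hM : 0 < M) {gA gB : ℕ → ℝ} {K k : ℕ} (hR : RAgree F ν gA gB k)

/-- **THE NO-LARGE-FIELD RUN-B INDEX TRUNCATES TO THE NO-LARGE-FIELD RUN-A INDEX** (`blockDownSet T_η = T_η` on the window): `truncSeq top_B = top_A`, where `top` is
`Seq.top` at `Node00.univ_mem_dOfRecord`. [cite: Balaban1989LargeFieldI, (0.2) p.176; Balaban1988Convergent, (2.18) p.257 (bookkeeping)] -/
theorem truncSeq_top :
    truncSeq F ν hM hR (Seq.top (DOfRecord F ν M gB (K + 1)) (k + 1) fun j _ _ => univ_mem_dOfRecord F ν hM gB (K + 1) j)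
      = Seq.top (DOfRecord F ν M gA K) k fun j _ _ => univ_mem_dOfRecord F ν hM gA K j := by
  apply Seq.ext'
  · funext j
    by_cases hj : 1 ≤ j ∧ j ≤ k
    · rw [truncSeq_Ω F ν hM hR _ hj.1 hj.2]
      simp [Seq.top, hj.1, hj.2, blockDownSet_univ]
    · rw [truncSeq_Ω_off F ν hM hR _ hj, (Seq.top (DOfRecord F ν M gA K) k _).Ω_off j hj]
  · funext j
    by_cases hj : 1 ≤ j ∧ j ≤ k
    · rw [truncSeq_Λ F ν hM hR _ hj.1 hj.2]
      simp [Seq.top, hj.1, hj.2, blockDownSet_univ]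
    · rw [(truncSeq F ν hM hR _).Λ_off j hj, (Seq.top (DOfRecord F ν M gA K) k _).Λ_off j hj]

/-- **… AND IS ITS ONLY PARTNER** (`k ≥ 1`): the lift of the no-large-field run-A index is the no-large-field run-B index, so the `truncSeq`-fibre over `top_A` is `{top_B}` — the
small-field terms `ρ(∅, V)` of [LF-I] (0.2) of the two runs are compared ONE TO ONE. [cite: Balaban1989LargeFieldI, (0.2) p.176; Balaban1988Convergent, (2.18) p.257 (bookkeeping)] -/
theorem liftSeq_top (hk : 1 ≤ k) :
    liftSeq F ν hM hR (Seq.top (DOfRecord F ν M gA K) k fun j _ _ => univ_mem_dOfRecord F ν hM gA K j)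
      = Seq.top (DOfRecord F ν M gB (K + 1)) (k + 1) fun j _ _ => univ_mem_dOfRecord F ν hM gB (K + 1) j := by
  symm
  refine (truncSeq_eq_iff_eq_liftSeq_of_Ω_one F ν hM hR hk _ ?_ _).1 (truncSeq_top F ν hM hR)
  simp [Seq.top, hk]

open Classical in
/-- The `truncSeq`-fibre over the no-large-field run-A index is the singleton of the no-large-field run-B index (`k ≥ 1`). [cite: Balaban1989LargeFieldI, (0.2) p.176 (bookkeeping)] -/
theorem filter_truncSeq_eq_top (hk : 1 ≤ k) :
    Finset.univ.filter (fun s' : SeqOfRecord F ν M gB (K + 1) (k + 1) =>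
        truncSeq F ν hM hR s' = Seq.top (DOfRecord F ν M gA K) k fun j _ _ => univ_mem_dOfRecord F ν hM gA K j)
      = {Seq.top (DOfRecord F ν M gB (K + 1)) (k + 1) fun j _ _ => univ_mem_dOfRecord F ν hM gB (K + 1) j} := by
  rw [filter_truncSeq_eq_singleton_liftSeq F ν hM hR hk _ (by simp [Seq.top, hk]), liftSeq_top F ν hM hR hk]

end Top

/-- **A6, THE OTHER SIDE: THE BAD CLASS IS INHABITED** at every cutoff with policy `1 ≤ jcut K ≤ k` — the ALL-LARGE-FIELD run-A index (`Ω_j = Λ_j = ∅` on the window; admissible: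
`∅` is a union of no cubes) has `Λ_{jcut K} = ∅ ≠ T_η`, so its σ-key lies in `badKeysSigma F T jcut` for any class set `T` containing run A's keys.  (The persistence class is
neither empty nor everything: `top` is good, this index is bad — the WEIGHTS decide, not the bookkeeping.) [cite: Balaban1988Convergent, (2.1) p.254, (2.18) p.257; Balaban1989LargeFieldII, (1.80) p.384 (bookkeeping)] -/
theorem exists_sigma_twoRunKeyA_mem_badKeysSigma (ν : Stage7Numerics) (M : ℕ) (gA : ℕ → ℝ) {K₀ : ℕ} (T : Finset (Σ K, SiteSeqKey F (K₀ + K)))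
    (jcut : ℕ → ℕ) (K : ℕ) {k : ℕ} (h1 : 1 ≤ jcut K) (hj : jcut K ≤ k)
    (hT : ∀ s : SeqOfRecord F ν M gA (K₀ + K) k, (⟨K, twoRunKeyA F ν M gA (K₀ + K) k s⟩ : Σ K, SiteSeqKey F (K₀ + K)) ∈ T) :
    ∃ s : SeqOfRecord F ν M gA (K₀ + K) k, (⟨K, twoRunKeyA F ν M gA (K₀ + K) k s⟩ : Σ K, SiteSeqKey F (K₀ + K)) ∈ badKeysSigma F T jcut := by
  let s : SeqOfRecord F ν M gA (K₀ + K) k :=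
    Seq.ofChain (fun _ => ∅) (fun _ => ∅)
      (Chain21.of_eq _ k _ (fun j _ _ => empty_mem_unionsOfCubes (F.P (K₀ + K)) _) (fun _ _ _ => le_rfl))
  refine ⟨s, (N20TwoRunKeyedPersistentWeight.sigma_twoRunKeyA_mem_badKeysSigma_iff F ν M gA T jcut K h1 hj s (hT s)).2 ?_⟩
  show (Seq.ofChain _ _ _).Λ (jcut K) ≠ Set.univ
  rw [Seq.ofChain_Λ _ h1 hj]
  exact Set.empty_ne_univ

end Summit.QuantumFields.YangMills.BalabanUVNodes.N20TwoRunKeyedGoodFibre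

end
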